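import Literature.NumberTheory.LFunctions.ChebyshevHalfLineBiasCharactersProofs
import Literature.Barriers.RiemannHypothesis.FeketePolyaPositivityProofs
import HarnessLib

/-!
# GRH(χ₄)-IMPLYING halves of Suzuki 2025 Thms 3 and 4, PROVED — «nothing here bears on the truth of RH»
# (1.14) `Σ_{n ≤ x} Λ(n)χ₄(n) n^{-1/2} log(x/n) ≤ 0` eventually ⟹ GRH for `L(s, χ₄)`; (1.18) `→ −∞` ⟹ GRH for `L(s, χ₄)`

M. Suzuki, *On variants of Chebyshev's conjecture*, Ramanujan J. **68** (2025) 95 = arXiv:2411.07436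
[`Suzuki2025Chebyshev`; PUBLISHED, refereed], §1.2, AS PRINTED. **Theorem 3**: «The following three statements are
equivalent: (i) The GRH for `L(s, χ₄)` holds. (ii) There exists an `x₀ ≥ 2` such that
`Σ_{n ≤ x} Λ(n)χ₄(n) n^{-1/2} log(x/n) ≤ 0` (1.14) holds for all `x ≥ x₀`. (iii) …» **Theorem 4**: «The GRH for `L(s, χ₄)`
holds if and only if `lim_{x→∞} Σ_{2 < p ≤ x} (−1)^{(p−1)/2} log p · √(x/p) log(x/p) = −∞` (1.18).» §1.2 / §4: Thm 3 is
Thm 8 and Thm 4 is Thm 9 at `χ = χ₄`, «using `L(σ, χ₄) ≠ 0` for `σ > 0`» (resp. «`L(1/2, χ₄) ≠ 0`»).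

PROVED here (kernel consequences of the tree's discharges `Suzuki2025Chebyshev_thm8_sign_holds`,
`Suzuki2025Chebyshev_thm9_sign_holds` of `ChebyshevHalfLineBiasCharactersProofs.lean`, at `q = 4`, `χ = χ₄`, `β = 1/2`):
* `Suzuki2025Chebyshev_thm3_ii_imp_i` — Thm 3, **(ii) ⟹ (i)**;
* `Suzuki2025Chebyshev_thm4_mpr` — Thm 4, **(1.18) ⟹ GRH for `L(s, χ₄)`**.
The input «`L(σ, χ₄) ≠ 0` for `σ > 0`» is the tree's Fekete–Pólya positivity
`Literature.Barriers.RiemannHypothesis.LFunction_re_pos_of_summatory_nonneg` (MV §11.2.1 Exercise 7 (a)) fed with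
`S_1(N, χ₄) = Σ_{n ≤ N} χ₄(n) ∈ {0, 1}` (`summatory_χ₄`). The converse halves ((i) ⟹ (ii), (i) ⟺ (iii); GRH ⟹ (1.18)) are
the explicit-formula asymptotics of the named facts `Suzuki2025Chebyshev_thm3` / `_thm4` / `_thm8_limits` / `_thm9_asymp`
and are NOT proved here. GRH(χ₄)-IMPLYING criteria; nothing in this file is, or is worded as, progress toward RH or GRH.
Theorems only (D-0014/D-0026); no definitions (`χ₄` as a complex character is spelled `ZMod.χ₄.ringHomComp (Int.castRingHom ℂ)`
as in `ChebyshevHalfLineBiasVariants.lean`).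

## References
* [Suzuki2025Chebyshev] M. Suzuki, Ramanujan J. 68 (2025) 95 = arXiv:2411.07436: §1.2 Thms 3, 4; §4.1 (Thm 8 ⟹ Thm 3),
  §4.2 (Thm 9 ⟹ Thm 4).
* [MontgomeryVaughan2007] H. L. Montgomery, R. C. Vaughan, *Multiplicative Number Theory I*, §11.2.1 Exercise 7 (a)
  (Fekete–Pólya: `S_1 ≥ 0 ⟹ L(σ, χ) > 0`).
-/

noncomputable section

open Complex Filter Topology Set ArithmeticFunction
open scoped Real

namespace Literature.NumberTheory.LFunctions

namespace SuzukiChi4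

open Literature.Barriers.RiemannHypothesis

/-- `χ₄(n)` as a complex number is the integer `χ₄(n)`. [folklore] -/
private theorem χ₄C_apply (n : ℕ) :
    (ZMod.χ₄.ringHomComp (Int.castRingHom ℂ)) (n : ZMod 4) = ((ZMod.χ₄ (n : ZMod 4) : ℤ) : ℂ) := by
  rw [MulChar.ringHomComp_apply]
  simp

/-- `Re χ₄(n) = χ₄(n)`. [folklore] -/
private theorem χ₄C_re (n : ℕ) :
    ((ZMod.χ₄.ringHomComp (Int.castRingHom ℂ)) (n : ZMod 4)).re = (ZMod.χ₄ (n : ZMod 4) : ℝ) := by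
  rw [χ₄C_apply, Complex.intCast_re]

/-- `χ₄` is real. [folklore] -/
private theorem χ₄C_im (a : ZMod 4) : ((ZMod.χ₄.ringHomComp (Int.castRingHom ℂ)) a).im = 0 := by
  rw [MulChar.ringHomComp_apply]
  simp

/-- `χ₄ ≠ χ₀` (`χ₄(3) = −1`). [folklore] -/
private theorem χ₄C_ne_one : ZMod.χ₄.ringHomComp (Int.castRingHom ℂ) ≠ 1 := by
  intro h
  have h3 := congrArg (fun χ : DirichletCharacter ℂ 4 ↦ χ (3 : ZMod 4)) h
  have hu : IsUnit (3 : ZMod 4) := IsUnit.of_mul_eq_one (3 : ZMod 4) (by decide)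
  simp only [MulChar.ringHomComp_apply, MulChar.one_apply hu] at h3
  have hv : ZMod.χ₄ (3 : ZMod 4) = -1 := by decide
  rw [hv] at h3
  norm_num at h3

/-- The values of `Re χ₄(n)` by residue class. [folklore] -/
private theorem χ₄C_re_eq (n : ℕ) : ((ZMod.χ₄.ringHomComp (Int.castRingHom ℂ)) (n : ZMod 4)).re =
    if n % 2 = 0 then 0 else if n % 4 = 1 then 1 else -1 := by
  rw [χ₄C_re, ZMod.χ₄_nat_eq_if_mod_four]
  split_ifs <;> simp

/-- `S_1(N, χ₄) = Σ_{n ≤ N} χ₄(n)` is `1` for `N ≡ 1, 2 (mod 4)` and `0` otherwise. [folklore] -/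
private theorem summatory_χ₄ (N : ℕ) :
    summatory (fun n ↦ ((ZMod.χ₄.ringHomComp (Int.castRingHom ℂ)) (n : ZMod 4)).re) N =
      if N % 4 = 1 ∨ N % 4 = 2 then 1 else 0 := by
  induction N with
  | zero => simp
  | succ N ih =>
    simp only [summatory_succ, ih]
    rw [χ₄C_re_eq]
    have h4 : (N + 1) % 4 = (N % 4 + 1) % 4 := by omega
    have h2 : (N + 1) % 2 = (N % 4 + 1) % 2 := by omega
    have : N % 4 < 4 := Nat.mod_lt _ (by norm_num)
    interval_cases hN : N % 4 <;> simp [h4, h2]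

/-- `L(σ, χ₄) ≠ 0` for real `σ > 0` (Fekete–Pólya with `S_1(N, χ₄) ≥ 0`).
[cite: MontgomeryVaughan2007, §11.2.1 Exercise 7 (a)–(b)] -/
theorem LFunction_χ₄_ne_zero_of_pos {σ : ℝ} (hσ : 0 < σ) :
    DirichletCharacter.LFunction (ZMod.χ₄.ringHomComp (Int.castRingHom ℂ) : DirichletCharacter ℂ 4) (σ : ℂ) ≠ 0 := by
  have hS : ∀ N : ℕ, 1 ≤ N →
      0 ≤ summatory (fun n ↦ ((ZMod.χ₄.ringHomComp (Int.castRingHom ℂ)) (n : ZMod 4)).re) N := by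
    intro N _
    rw [summatory_χ₄]
    split_ifs <;> norm_num
  have hpos := LFunction_re_pos_of_summatory_nonneg _ χ₄C_ne_one hS hσ
  intro h0
  rw [h0, Complex.zero_re] at hpos
  exact lt_irrefl _ hpos

end SuzukiChi4

open SuzukiChi4 in
/-- **Suzuki 2025, Theorem 3, (ii) ⟹ (i), PROVED**: if there is `x₀ ≥ 2` with
`Σ_{n ≤ x} Λ(n)χ₄(n) n^{-1/2} log(x/n) ≤ 0` for all `x ≥ x₀` ((1.14)), then the GRH for `L(s, χ₄)` holds (the tree's open-strip
`DirichletCharacter.RiemannHypothesis`). Thm 8 (first half) at `χ = χ₄`, `β = 1/2`, with `L(σ, χ₄) ≠ 0` for `σ > 0`.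
[cite: Suzuki2025Chebyshev, §1.2 Thm 3 ((ii) ⟹ (i)) with §4.1 Thm 8] -/
theorem Suzuki2025Chebyshev_thm3_ii_imp_i
    (h : ∃ x₀ : ℝ, 2 ≤ x₀ ∧ ∀ x : ℝ, x₀ ≤ x →
      ∑ n ∈ Finset.Icc 1 ⌊x⌋₊, Λ n * (ZMod.χ₄ (n : ZMod 4) : ℝ) / Real.sqrt n * Real.log (x / n) ≤ 0) :
    DirichletCharacter.RiemannHypothesis (ZMod.χ₄.ringHomComp (Int.castRingHom ℂ) : DirichletCharacter ℂ 4) := by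
  obtain ⟨x₀, hx₀, hle⟩ := h
  have H := Suzuki2025Chebyshev_thm8_sign_holds 4 (ZMod.χ₄.ringHomComp (Int.castRingHom ℂ)) SuzukiChi4.χ₄C_ne_one
    (1 / 2) le_rfl (by norm_num) (fun σ h1 _ ↦ LFunction_χ₄_ne_zero_of_pos (by linarith))
    ⟨x₀, hx₀, Or.inr fun x hx ↦ by simpa only [SuzukiChi4.χ₄C_re] using hle x hx⟩
  exact H.2 rfl

open SuzukiChi4 in
/-- **Suzuki 2025, Theorem 4, «if» direction, PROVED**: if
`Σ_{2 < p ≤ x} (−1)^{(p−1)/2} log p · √(x/p) log(x/p) → −∞` ((1.18)), then the GRH for `L(s, χ₄)` holds. Thm 9 (first half) at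
`χ = χ₄` (real, non-principal), `β = 1/2`, with `L(σ, χ₄) ≠ 0` for `σ > 0`; `(−1)^{(p−1)/2} = χ₄(p)` for odd primes and
`χ₄(2) = 0`. [cite: Suzuki2025Chebyshev, §1.2 Thm 4 («if») with §4.2 Thm 9] -/
theorem Suzuki2025Chebyshev_thm4_mpr
    (h : Tendsto (fun x : ℝ ↦ ∑ p ∈ (Finset.Ioc 2 ⌊x⌋₊).filter Nat.Prime,
      (-1 : ℝ) ^ ((p - 1) / 2) * Real.log p * Real.sqrt (x / p) * Real.log (x / p)) atTop atBot) :
    DirichletCharacter.RiemannHypothesis (ZMod.χ₄.ringHomComp (Int.castRingHom ℂ) : DirichletCharacter ℂ 4) := by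
  set χ : DirichletCharacter ℂ 4 := ZMod.χ₄.ringHomComp (Int.castRingHom ℂ) with hχ_def
  obtain ⟨x₀, hx₀⟩ := eventually_atTop.1 (h.eventually (eventually_le_atBot 0))
  -- the two prime sums agree: `χ₄(2) = 0` and `χ₄(p) = (−1)^{(p−1)/2}` for odd `p`
  have hsum : ∀ x : ℝ, ∑ p ∈ (Finset.Icc 1 ⌊x⌋₊).filter Nat.Prime,
        (χ (p : ZMod 4)).re * Real.log p * Real.sqrt (x / p) * Real.log (x / p) =
      ∑ p ∈ (Finset.Ioc 2 ⌊x⌋₊).filter Nat.Prime,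
        (-1 : ℝ) ^ ((p - 1) / 2) * Real.log p * Real.sqrt (x / p) * Real.log (x / p) := by
    intro x
    have hsub : (Finset.Ioc 2 ⌊x⌋₊).filter Nat.Prime ⊆ (Finset.Icc 1 ⌊x⌋₊).filter Nat.Prime := by
      intro p hp
      simp only [Finset.mem_filter, Finset.mem_Ioc, Finset.mem_Icc] at hp ⊢
      exact ⟨⟨by omega, hp.1.2⟩, hp.2⟩
    have hzero : ∀ p ∈ (Finset.Icc 1 ⌊x⌋₊).filter Nat.Prime, p ∉ (Finset.Ioc 2 ⌊x⌋₊).filter Nat.Prime →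
        (χ (p : ZMod 4)).re * Real.log p * Real.sqrt (x / p) * Real.log (x / p) = 0 := by
      intro p hp hp'
      rw [Finset.mem_filter, Finset.mem_Icc] at hp
      rw [Finset.mem_filter, Finset.mem_Ioc] at hp'
      have hp2 : p = 2 := by
        by_contra hne
        have h2 := hp.2.two_le
        exact hp' ⟨⟨by omega, hp.1.2⟩, hp.2⟩
      subst hp2
      rw [hχ_def, SuzukiChi4.χ₄C_re_eq]
      norm_num
    rw [← Finset.sum_subset hsub hzero]
    refine Finset.sum_congr rfl fun p hp ↦ ?_
    rw [Finset.mem_filter, Finset.mem_Ioc] at hp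
    have hodd : p % 2 = 1 := by
      rcases Nat.even_or_odd p with he | ho
      · exfalso
        rcases hp.2.eq_one_or_self_of_dvd 2 (even_iff_two_dvd.1 he) with h2 | h2 <;> omega
      · exact Nat.odd_iff.1 ho
    rw [hχ_def, SuzukiChi4.χ₄C_re, ZMod.χ₄_eq_neg_one_pow hodd, show (p - 1) / 2 = p / 2 by omega]
    push_cast
    ring
  have H := Suzuki2025Chebyshev_thm9_sign_holds 4 χ SuzukiChi4.χ₄C_ne_one SuzukiChi4.χ₄C_im
    (1 / 2) le_rfl (by norm_num) (fun σ h1 _ ↦ LFunction_χ₄_ne_zero_of_pos (by linarith))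
    ⟨x₀, fun x hx ↦ by rw [hsum x]; exact hx₀ x hx⟩
  exact H.2 rfl

end Literature.NumberTheory.LFunctions

end
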